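import Mathlib
import Summits.Ventures.HodgeRepro2.T5CyclotomicSubfieldHeckeCommutative
import Summits.Ventures.HodgeRepro2.T5CyclotomicSubfieldInfinitude
import Summits.Ventures.HodgeRepro2.T5CyclotomicInfinitelyManyPlaces

/-!
# `k[X]` AT INFINITELY MANY PLACES, COMMUTATIVE AT INFINITELY MANY SPLIT PLACES, FOR EVERY CM SUBFIELD OF `ℚ(ζₘ)`
# AND EVERY HERMITIAN GRAM MATRIX

Tier-5 support N3 / §G-N4.2 (seat p3, gen 82). File 304 made the exceptional set of the record's Hecke
commutativity explicit for every CM subfield `F ⊆ ℚ(ζₘ)`; file 296 gave infinitely many primes `p ≡ −1 mod m`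
(degree-one inert places, `v` stays prime) and infinitely many `p ≡ 1 mod m` (`v` has two primes above it); file 274
chooses a place above each prime injectively; file 222 bounds the bad places of any Gram matrix `H` by a finite set.
Together, for EVERY `H` (hermitian, unit determinant) and every field `k`:

* `recordCommutative_of_recordPolynomial` — `k[X]` is commutative, so `RecordPolynomial ⇒ RecordCommutative`;
* `vNegOf` / `vOneOf` — a chosen place of `F⁺` above each prime `p ≡ −1` / `p ≡ 1 mod m` (injective in `p`);
  `exists_map_eq_vNegOf` (it stays prime in `F`), `ncard_primesOver_vOneOf` (two primes of `F` above it);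
* **`infinite_setOf_recordPolynomial`** — `H(U(1 ⊗ H), K_v) ≃ k[X]` at INFINITELY MANY places `v` of `F⁺` (for
  every generator family `l`); **`infinite_setOf_recordCommutative`** — commutative at infinitely many places;
* **`infinite_setOf_ncard_primesOver_eq_two_and_recordCommutative`** — infinitely many SPLIT places (two primes
  above `v`) at which the algebra is commutative.

The inert regime of the record's Satake chain (file 295) and its `k[X]` structure are thereby inhabited infinitely
often on every abelian CM field presented inside a cyclotomic field, for every Gram matrix — the general form of
file 274's statements on `ℚ(ζ_ℓ)` with the toy matrix. §8(d): uses an L-value-free non-vanishing device: NO.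
-/

open Matrix NumberField NumberField.IsCMField IsDedekindDomain IsDedekindDomain.HeightOneSpectrum Module Polynomial
  Ideal
open scoped TensorProduct Pointwise
open Summit.Ventures.HodgeRepro2.T5UnitaryGroupForm Summit.Ventures.HodgeRepro2.T5UnitaryHeckeAdjoint
  Summit.Ventures.HodgeRepro2.T5HeckePermutationModule Summit.Ventures.HodgeRepro2.T5HeckeDoubleCoset
  Summit.Ventures.HodgeRepro2.T5RecordHyperspecial Summit.Ventures.HodgeRepro2.T5GlobalLatticeAlmostAll
  Summit.Ventures.HodgeRepro2.T5FinitePlaceSplitClassification Summit.Ventures.HodgeRepro2.T5RecordSatakeIntrinsic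
  Summit.Ventures.HodgeRepro2.T5SplitPlaceUnitaryGroup Summit.Ventures.HodgeRepro2.T5NonSplitPlaceUnitaryGroup
  Summit.Ventures.HodgeRepro2.T5FinitePlaceCM Summit.Ventures.HodgeRepro2.T5StarOfInvolution
  Summit.Ventures.HodgeRepro2.T5CyclotomicSevenHeckeCommutative
  Summit.Ventures.HodgeRepro2.T5CyclotomicSubfieldHeckeCommutative
  Summit.Ventures.HodgeRepro2.T5CyclotomicSubfieldInertiaDeg
  Summit.Ventures.HodgeRepro2.T5CyclotomicSubfieldInfinitude
  Summit.Ventures.HodgeRepro2.T5CyclotomicInfinitelyManyPlaces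

namespace Summit.Ventures.HodgeRepro2.T5CyclotomicSubfieldHeckeInfinitude

section Generic

/-- **An algebra isomorphic to `k[X]` is commutative** (generic: transport of `mul_comm` along the isomorphism). -/
theorem mul_comm_of_nonempty_algEquiv_polynomial {k A : Type*} [CommSemiring k] [Semiring A] [Algebra k A]
    (h : Nonempty (k[X] ≃ₐ[k] A)) (T S : A) : T * S = S * T := by
  obtain ⟨e⟩ := h
  obtain ⟨P, rfl⟩ := e.surjective T
  obtain ⟨Q, rfl⟩ := e.surjective S
  rw [← map_mul, ← map_mul, mul_comm]

variable (K : Type*) [Field K] [NumberField K] [IsCMField K]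
variable (v : HeightOneSpectrum (𝓞 (maximalRealSubfield K)))
variable {r : ℕ} (l : Fin r → 𝓞 K) (k : Type*) [Field k]

/-- **`k[X]` is commutative**: `RecordPolynomial ⇒ RecordCommutative`. -/
theorem recordCommutative_of_recordPolynomial {H : Matrix (Fin 3) (Fin 3) K} (h : RecordPolynomial K v l k H) :
    RecordCommutative K v l k H :=
  fun T S => mul_comm_of_nonempty_algEquiv_polynomial h T S

end Generic

section Chosen

variable (m : ℕ) [NeZero m] (L : Type*) [Field L] [NumberField L] [IsCyclotomicExtension {m} ℚ L] [IsCMField L]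
  (F : IntermediateField ℚ L) [IsCMField F]

omit [NeZero m] [IsCyclotomicExtension {m} ℚ L] [IsCMField L] [IsCMField F] in
/-- A prime `p ≡ −1 mod m` is coprime to `m`. -/
theorem coprime_of_eq_neg_one_mod (p : ℕ) (h : (p : ZMod m) = -1) : p.Coprime m :=
  (ZMod.isUnit_iff_coprime p m).mp (by rw [h]; exact isUnit_one.neg)

omit [NeZero m] [IsCyclotomicExtension {m} ℚ L] [IsCMField L] [IsCMField F] in
/-- A prime `p ≡ 1 mod m` is coprime to `m`. -/
theorem coprime_of_eq_one_mod (p : ℕ) (h : (p : ZMod m) = 1) : p.Coprime m :=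
  (ZMod.isUnit_iff_coprime p m).mp (by rw [h]; exact isUnit_one)

/-- A chosen place of `F⁺` above each prime `p ≡ −1 mod m` (file 274's `placeAboveCyc`). -/
noncomputable def vNegOf (p : {p : ℕ // p.Prime ∧ (p : ZMod m) = -1}) :
    HeightOneSpectrum (𝓞 (maximalRealSubfield F)) :=
  haveI : Fact p.1.Prime := ⟨p.2.1⟩
  placeAboveCyc F p.1

/-- A chosen place of `F⁺` above each prime `p ≡ 1 mod m`. -/
noncomputable def vOneOf (p : {p : ℕ // p.Prime ∧ (p : ZMod m) = 1}) :
    HeightOneSpectrum (𝓞 (maximalRealSubfield F)) :=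
  haveI : Fact p.1.Prime := ⟨p.2.1⟩
  placeAboveCyc F p.1

omit [NeZero m] [IsCyclotomicExtension {m} ℚ L] [IsCMField L] [IsCMField F] in
/-- `vNegOf p` lies above `p`. -/
theorem liesOver_vNegOf (p : {p : ℕ // p.Prime ∧ (p : ZMod m) = -1}) :
    (vNegOf m L F p).asIdeal.LiesOver (span {(p.1 : ℤ)}) :=
  liesOver_placeAboveCyc F p.1 (hp := ⟨p.2.1⟩)

omit [NeZero m] [IsCyclotomicExtension {m} ℚ L] [IsCMField L] [IsCMField F] in
/-- `vOneOf p` lies above `p`. -/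
theorem liesOver_vOneOf (p : {p : ℕ // p.Prime ∧ (p : ZMod m) = 1}) :
    (vOneOf m L F p).asIdeal.LiesOver (span {(p.1 : ℤ)}) :=
  liesOver_placeAboveCyc F p.1 (hp := ⟨p.2.1⟩)

omit [NeZero m] [IsCyclotomicExtension {m} ℚ L] [IsCMField L] [IsCMField F] in
/-- `vNegOf` is injective (a place lies above one rational prime). -/
theorem vNegOf_injective : Function.Injective (vNegOf m L F) := fun p q h =>
  Subtype.ext (placeAboveCyc_injective_of_prime F p.2.1 q.2.1 h)

omit [NeZero m] [IsCyclotomicExtension {m} ℚ L] [IsCMField L] [IsCMField F] in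
/-- `vOneOf` is injective. -/
theorem vOneOf_injective : Function.Injective (vOneOf m L F) := fun p q h =>
  Subtype.ext (placeAboveCyc_injective_of_prime F p.2.1 q.2.1 h)

/-- **`vNegOf p` stays prime in `F`** (file 296: `p ≡ −1 mod m` gives degree-one inert places). -/
theorem exists_map_eq_vNegOf (p : {p : ℕ // p.Prime ∧ (p : ZMod m) = -1}) :
    ∃ w : HeightOneSpectrum (𝓞 F),
      Ideal.map (algebraMap (𝓞 (maximalRealSubfield F)) (𝓞 F)) (vNegOf m L F p).asIdeal = w.asIdeal := by
  haveI : Fact p.1.Prime := ⟨p.2.1⟩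
  haveI := liesOver_vNegOf m L F p
  obtain ⟨𝔭, h𝔭, h𝔭v⟩ := (Ideal.nonempty_primesOver (S := 𝓞 F) (vNegOf m L F p).asIdeal).some
  haveI := h𝔭
  haveI := h𝔭v
  haveI : 𝔭.LiesOver (span {(p.1 : ℤ)}) := Ideal.LiesOver.trans 𝔭 (vNegOf m L F p).asIdeal (span {(p.1 : ℤ)})
  exact (exists_map_eq_of_eq_neg_one_mod m L F p.1 (coprime_of_eq_neg_one_mod m p.1 p.2.2) 𝔭
    (vNegOf m L F p) p.2.2).2.2

/-- **Two primes of `F` above `vOneOf p`** (file 296: `p ≡ 1 mod m` splits completely). -/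
theorem ncard_primesOver_vOneOf (p : {p : ℕ // p.Prime ∧ (p : ZMod m) = 1}) :
    ((vOneOf m L F p).asIdeal.primesOver (𝓞 F)).ncard = 2 := by
  haveI : Fact p.1.Prime := ⟨p.2.1⟩
  haveI := liesOver_vOneOf m L F p
  obtain ⟨𝔭, h𝔭, h𝔭v⟩ := (Ideal.nonempty_primesOver (S := 𝓞 F) (vOneOf m L F p).asIdeal).some
  haveI := h𝔭
  haveI := h𝔭v
  haveI : 𝔭.LiesOver (span {(p.1 : ℤ)}) := Ideal.LiesOver.trans 𝔭 (vOneOf m L F p).asIdeal (span {(p.1 : ℤ)})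
  exact (inertiaDeg_eq_one_of_eq_one_mod m L F p.1 (coprime_of_eq_one_mod m p.1 p.2.2) 𝔭
    (vOneOf m L F p) p.2.2).2

end Chosen

section Infinite

variable (m : ℕ) [NeZero m] (L : Type*) [Field L] [NumberField L] [IsCyclotomicExtension {m} ℚ L] [IsCMField L]
  (F : IntermediateField ℚ L) [IsCMField F]
variable (k : Type*) [Field k]

include m in
/-- **`k[X]` AT INFINITELY MANY PLACES OF `F⁺`, FOR EVERY GRAM MATRIX**: for every hermitian `H` with unit
determinant, the set of places `v` of `F⁺` at which `H(U(1 ⊗ H), K_v) ≃ k[X]` for every generator family `l` is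
infinite — the chosen places above the primes `p ≡ −1 mod m` (Dirichlet, file 296), minus the finitely many places
under a bad place of `H` (file 222). -/
theorem infinite_setOf_recordPolynomial {H : Matrix (Fin 3) (Fin 3) F} (hH : H.IsHermitian)
    (hdet : IsUnit H.det) :
    {v : HeightOneSpectrum (𝓞 (maximalRealSubfield F)) | ∀ {r : ℕ} (l : Fin r → 𝓞 F),
      Submodule.span (𝓞 (maximalRealSubfield F)) (Set.range l) = ⊤ → RecordPolynomial F v l k H}.Infinite := by
  haveI : Infinite {p : ℕ // p.Prime ∧ (p : ZMod m) = -1} := (infinite_setOf_prime_eq_neg_one_mod m).to_subtype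
  have hinf : (Set.range (vNegOf m L F)).Infinite := Set.infinite_range_of_injective (vNegOf_injective m L F)
  refine (hinf.sdiff (finite_setOf_exists_liesOver_mem_badSet (K := maximalRealSubfield F) H)).mono ?_
  rintro v ⟨⟨p, rfl⟩, hv⟩
  intro r l hl
  obtain ⟨w, hmap⟩ := exists_map_eq_vNegOf m L F p
  refine recordPolynomial_of_map_eq F _ l k w hmap hl hH hdet fun hw => hv ?_
  exact ⟨w, hw, liesOver_of_map_eq F _ w hmap⟩

include m in
/-- **Commutative at infinitely many places of `F⁺`, for every Gram matrix.** -/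
theorem infinite_setOf_recordCommutative {H : Matrix (Fin 3) (Fin 3) F} (hH : H.IsHermitian)
    (hdet : IsUnit H.det) :
    {v : HeightOneSpectrum (𝓞 (maximalRealSubfield F)) | ∀ {r : ℕ} (l : Fin r → 𝓞 F),
      Submodule.span (𝓞 (maximalRealSubfield F)) (Set.range l) = ⊤ → RecordCommutative F v l k H}.Infinite := by
  refine (infinite_setOf_recordPolynomial m L F k hH hdet).mono ?_
  intro v hv r l hl
  exact recordCommutative_of_recordPolynomial F v l k (hv l hl)

include m in
/-- **Infinitely many SPLIT places of `F⁺` at which the algebra is commutative, for every Gram matrix**: the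
chosen places above the primes `p ≡ 1 mod m` (two primes of `F` above each, file 296), minus the finitely many
places under a bad place of `H`. -/
theorem infinite_setOf_ncard_primesOver_eq_two_and_recordCommutative {H : Matrix (Fin 3) (Fin 3) F}
    (hH : H.IsHermitian) (hdet : IsUnit H.det) :
    {v : HeightOneSpectrum (𝓞 (maximalRealSubfield F)) | (v.asIdeal.primesOver (𝓞 F)).ncard = 2 ∧
      ∀ {r : ℕ} (l : Fin r → 𝓞 F), Submodule.span (𝓞 (maximalRealSubfield F)) (Set.range l) = ⊤ →
        RecordCommutative F v l k H}.Infinite := by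
  haveI : Infinite {p : ℕ // p.Prime ∧ (p : ZMod m) = 1} := (infinite_setOf_prime_eq_one_mod m).to_subtype
  have hinf : (Set.range (vOneOf m L F)).Infinite := Set.infinite_range_of_injective (vOneOf_injective m L F)
  refine (hinf.sdiff (finite_setOf_exists_liesOver_mem_badSet (K := maximalRealSubfield F) H)).mono ?_
  rintro v ⟨⟨p, rfl⟩, hv⟩
  refine ⟨ncard_primesOver_vOneOf m L F p, fun {r} l hl => ?_⟩
  refine recordCommutative_of_ncard_primesOver_eq_two F _ l k (ncard_primesOver_vOneOf m L F p) hl hH hdet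
    fun w hw hbad => hv ⟨w, hbad, hw⟩

end Infinite

end Summit.Ventures.HodgeRepro2.T5CyclotomicSubfieldHeckeInfinitude
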